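import Summits.AtomisticToContinuum.Crystallization.Theorems.ChargedEnergyGapWeightPieces
import HarnessLib

/-!
# `ChargedEnergyGap` — the TRANSITION SHELL and the split of the cored far leaf by SHELL BUDGET
# (cell `decomp-a2c`, lens 3, generation 52, node «WeightLedger», part O-D; over part O-B `…Theorems.ChargedEnergyGapWeightPieces`)

THE DIAGNOSIS BEHIND THE SPLIT (memo g51 §2, memo g52 §3).  What the cored far leaf CB-FAR_W|cored has to absorb is the first-order
TRANSFER between the far account and the balls across the transition shell `{0 < W.far < 1}`: a shell-normal displacement changes
`Σ_y far(y)(E_y − e*)` at first order through the third moment of `∇far`, and the harmonic optimum of (transfer − far share of the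
elastic energy) is a sum of a bounded amount PER SHELL SITE (max cover: `≈ 1.2·10⁻⁷` per site at the record scale `ϱ = 160`; memo g52
§3).  The leaf's slack is `c₁ = 1/20` PER INCOHERENT CORE.  So the analysis closes exactly when the number of shell sites per core is
bounded — by about `c₁/(3·1.2·10⁻⁷) ≈ 1.4·10⁵`.  Whether it is bounded is NOT analysis: it is a statement about the GEOMETRY OF THE CORE
SORTING (do unimprovable, deep-rigid, incoherent cores ever come in small isolated clusters?).  Line cores carry `≈ 2·10⁴` shell sites
per core, walls `≈ 2·10²`, a misoriented inclusion of radius `30` `≈ 3·10³`; an ISOLATED compact cluster of `n` cores carries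
`≈ 2.6·10⁷/n`, so the budget `10⁵` asks `n ≥ 260` — and compact defects of extent `< 10` (small loops, stacking-fault tetrahedra, tiny
inclusions) are `(10, 1/100)`-IMPROVABLE by fill-in / shrinking (line tension), hence never cores.

THE SPLIT (by hypothesis, not additive; generic in the weight system `W`).  With the TRANSITION-SHELL COUNT `shellCount W Q = #{y ∈
motif : 0 < W.far Q y < 1}` and a budget dial `B₀`:
  SHELL-BUDGET_W(B₀)   `ShellBudgetW W s B₀`: every guarded `Q` has `shellCount ≤ B₀ · #cores` — pure defect geometry, TRUE-leaning at
                       `B₀ = 10⁵`, INSTRUMENTABLE (census C8: shell sites per core over the zoo), ATTACKABLE-M (fill-in / line-tension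
                       improvability of small clusters);
  CB-FAR_W|cored,B₀    `FarLabelledFloorCoredBudgetW W c₁ s ρ₀ lam ℓ B₀`: the cored labelled far floor ASSUMING the shell budget —
                       the analytic content (Cauchy–Born on average in the bond gauge + transfer ≤ const · #shell), WEAKER than
                       CB-FAR_W|cored (`farLabelledFloorCoredBudgetW_of_cored`), TRUE-leaning for the max cover at `B₀ = 10⁵`,
                       INSTRUMENTABLE (census C10/C11), ATTACKABLE-L;
  glue (proved)        SHELL-BUDGET_W(B₀) ∧ CB-FAR_W|cored,B₀ ⟹ CB-FAR_W|cored (`farLabelledFloorCoredW_of_shellBudget`).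
THE DIAL IS HONEST AT BOTH ENDS (§2): under the guard EVERY weight system whose far weight drops below `1` only within `ϱ` of a core
(`CoversShell W`; both instances) satisfies SHELL-BUDGET_W at the packing constant `B₀ = (2ϱ/s + 1)³` OUTRIGHT
(`shellBudgetW_of_coversShell`), so at that end the budget leaf IS the unsplit leaf (★ `farLabelledFloorCoredW_iff_budget_packing`);
at the record end `B₀ = 10⁵ ≪ (2·160/(3/5) + 1)³ ≈ 1.5·10⁸` both halves carry content.

§1 Shell, count, the two pieces, dials, glue, WEAKER.  §2 `CoversShell`, ★ the packing shell budget, ★ EQUIV at the packing end, the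
weights of record cover their shell.  §3 Record `B₀ = 10⁵`: ★★ the nine-leaf cone for every `W`.

TAGS.  SHELL-BUDGET_W(10⁵): TRUE-leaning · INSTRUMENTABLE (C8) · ATTACKABLE-M.  CB-FAR_W|cored,10⁵: WEAKER than CB-FAR_W|cored · truth
depends on `W` (max cover TRUE-leaning; sum cover of record FALSE-leaning — thin shells make the per-site transfer unbounded) ·
INSTRUMENTABLE (C10/C11) · ATTACKABLE-L. -/

noncomputable section
open scoped Classical
open Literature.MathematicalPhysics.StatisticalMechanics
open Literature.Geometry.DiscreteGeometry
open Summit.AtomisticToContinuum.Crystallization.Theses.PricedLinkCensus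
open Summit.AtomisticToContinuum.Crystallization.Theorems.ChargedEnergyGapNegative

namespace Summit.AtomisticToContinuum.Crystallization.Theorems.ChargedEnergyGapChartDial

/-! ## §1 The transition shell, the two pieces, dials and glue -/

section Shell

variable {θ ε R r η L δ L' ϱ : ℝ} (W : CoreWeights θ ε R r η L δ L' ϱ)

/-- A motif site lies in the **TRANSITION SHELL** of the weight system `W` iff its far weight is strictly between `0` and `1` (for
the max cover: distance to the nearest core orbit strictly between `ϱ/2` and `ϱ`). -/
def InShell (Q : PeriodicConfiguration 3) (y : Q.motif) : Prop :=
  0 < W.far Q (y : E3) ∧ W.far Q (y : E3) < 1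

/-- The **SHELL COUNT**: the number of motif sites in the transition shell. -/
def shellCount (Q : PeriodicConfiguration 3) : ℕ :=
  Nat.card {y : Q.motif // InShell W Q y}

/-- The indicator sum of the shell over the motif is the shell count. -/
theorem sum_ite_inShell_eq (Q : PeriodicConfiguration 3) :
    (∑ y : Q.motif, if InShell W Q y then (1 : ℝ) else 0) = (shellCount W Q : ℝ) := by
  rw [Finset.sum_boole, shellCount, Nat.card_eq_fintype_card, Fintype.card_subtype]

variable (c₁ s ρ₀ lam ℓ B₀ : ℝ)

/-- piece SHELL-BUDGET_W(`B₀`) · TRUE-leaning at `B₀ = 10⁵` · INSTRUMENTABLE (census C8) · ATTACKABLE-M.  **SHELL BUDGET**: every guarded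
configuration has at most `B₀` transition-shell sites per incoherent core.  Why it might fail: a guarded configuration with an
ISOLATED compact cluster of fewer than `≈ 2.6·10⁷/B₀` (`= 260` at `B₀ = 10⁵`) unimprovable deep-rigid incoherent cores — a sessile
compact defect of extent `≳ 10` that no `10`-ball modification (fill-in, shrink, rotate back) improves by `1/100`. -/
def ShellBudgetW : Prop :=
  ∀ Q : PeriodicConfiguration 3, Guard ε s Q → (shellCount W Q : ℝ) ≤ B₀ * (motifCoreIncoherent θ ε R r η L δ L' Q : ℝ)

/-- piece CB-FAR_W|cored,`B₀` · WEAKER than CB-FAR_W|cored (`farLabelledFloorCoredBudgetW_of_cored`) · truth depends on `W` (max cover: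
TRUE-leaning at `B₀ = 10⁵`; sum cover of record: FALSE-leaning) · INSTRUMENTABLE (census C10/C11) · ATTACKABLE-L.  **FAR FLOOR GIVEN THE
LABELLINGS, CORED CONFIGURATIONS WITHIN SHELL BUDGET**: `FarLabelledFloorCoredW` asserted only for guarded cored configurations with
`shellCount ≤ B₀ · #cores`.  Why it might fail: the per-shell-site transfer optimum (`≈ 1.2·10⁻⁷` for the max cover at `ϱ = 160`)
times `B₀`, plus the reference-stacking dipole terms, exceeds `c₁ = 1/20` per core; or the Cauchy–Born-on-average floor of the pure
far region (`far ≡ 1`) loses a per-site amount (it must lose NOTHING per site: `2·10⁷` sites per isolated core). -/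
def FarLabelledFloorCoredBudgetW : Prop :=
  ∃ C₁ : ℝ, 0 ≤ C₁ ∧ ∀ Q : PeriodicConfiguration 3, Guard ε s Q → 0 < motifCoreIncoherent θ ε R r η L δ L' Q →
    (shellCount W Q : ℝ) ≤ B₀ * (motifCoreIncoherent θ ε R r η L δ L' Q : ℝ) →
    (∀ y : Q.motif, ¬ IsOtherGross θ ε R r η L δ L' Q y → ¬ NearOtherGross θ ε R r η L δ L' ρ₀ Q y →
        0 < W.far Q (y : E3) → LabelledWithin lam ℓ Q (y : E3)) →
      -(C₁ * farNearDebitW W ρ₀ Q) - c₁ * (motifCoreIncoherent θ ε R r η L δ L' Q : ℝ) ≤ farCleanExcessW W ρ₀ Q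

variable {c₁ s ρ₀ lam ℓ B₀}

/-- SHELL-BUDGET_W is monotone in the budget … -/
theorem ShellBudgetW.mono {B₀' : ℝ} (hB : B₀ ≤ B₀') (h : ShellBudgetW W s B₀) : ShellBudgetW W s B₀' := fun Q hQ =>
  (h Q hQ).trans (mul_le_mul_of_nonneg_right hB (Nat.cast_nonneg _))

/-- … and CB-FAR_W|cored,`B₀` antitone in it. -/
theorem FarLabelledFloorCoredBudgetW.anti {B₀' : ℝ} (hB : B₀' ≤ B₀) (h : FarLabelledFloorCoredBudgetW W c₁ s ρ₀ lam ℓ B₀) :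
    FarLabelledFloorCoredBudgetW W c₁ s ρ₀ lam ℓ B₀' := by
  obtain ⟨C₁, hC, h⟩ := h
  exact ⟨C₁, hC, fun Q hQ hpos hsh hlab => h Q hQ hpos (hsh.trans (mul_le_mul_of_nonneg_right hB (Nat.cast_nonneg _))) hlab⟩

/-- CB-FAR_W|cored,`B₀` is monotone in the slack `c₁`. -/
theorem FarLabelledFloorCoredBudgetW.mono {c₁' : ℝ} (hc : c₁ ≤ c₁') (h : FarLabelledFloorCoredBudgetW W c₁ s ρ₀ lam ℓ B₀) :
    FarLabelledFloorCoredBudgetW W c₁' s ρ₀ lam ℓ B₀ := by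
  obtain ⟨C₁, hC, h⟩ := h
  refine ⟨C₁, hC, fun Q hQ hpos hsh hlab => ?_⟩
  have h1 := h Q hQ hpos hsh hlab
  have h2 : c₁ * (motifCoreIncoherent θ ε R r η L δ L' Q : ℝ) ≤ c₁' * (motifCoreIncoherent θ ε R r η L δ L' Q : ℝ) :=
    mul_le_mul_of_nonneg_right hc (Nat.cast_nonneg _)
  linarith

/-- ★ **THE SPLIT** (glue, proved): SHELL-BUDGET_W(`B₀`) ∧ CB-FAR_W|cored,`B₀` ⟹ CB-FAR_W|cored (same coefficient). -/
theorem farLabelledFloorCoredW_of_shellBudget (hS : ShellBudgetW W s B₀) (hF : FarLabelledFloorCoredBudgetW W c₁ s ρ₀ lam ℓ B₀) :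
    FarLabelledFloorCoredW W c₁ s ρ₀ lam ℓ := by
  obtain ⟨C₁, hC, h⟩ := hF
  exact ⟨C₁, hC, fun Q hQ hpos hlab => h Q hQ hpos (hS Q hQ) hlab⟩

/-- WEAKER: CB-FAR_W|cored ⟹ CB-FAR_W|cored,`B₀` for every budget (drop the hypothesis). -/
theorem farLabelledFloorCoredBudgetW_of_cored (h : FarLabelledFloorCoredW W c₁ s ρ₀ lam ℓ) :
    FarLabelledFloorCoredBudgetW W c₁ s ρ₀ lam ℓ B₀ := by
  obtain ⟨C₁, hC, h⟩ := h
  exact ⟨C₁, hC, fun Q hQ hpos _ hlab => h Q hQ hpos hlab⟩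

end Shell

/-! ## §2 Weight systems that cover their shell; ★ the packing shell budget; ★ the EQUIV at the packing end -/

section Covers

variable {θ ε R r η L δ L' ϱ : ℝ} (W : CoreWeights θ ε R r η L δ L' ϱ)

/-- `W` **COVERS ITS SHELL**: wherever the far weight is below `1`, some incoherent core orbit is within `ϱ` (both the weights of
record and the max-cover weights do, for `0 < ϱ`: a far weight `< 1` means a positive core bump). -/
def CoversShell : Prop :=
  ∀ (Q : PeriodicConfiguration 3) (q : E3), W.far Q q < 1 →
    ∃ x : Q.motif, IsCore θ ε R r η L δ L' Q x ∧ ∃ g ∈ Q.lattice, dist q ((x : E3) + g) ≤ ϱ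

variable {W} {s : ℝ}

/-- ★ **THE PACKING SHELL BUDGET** (`0 < s`, `0 ≤ ϱ`): under the guard a weight system that covers its shell has at most
`(2ϱ/s + 1)³` shell sites per incoherent core — every shell site, translated into the `ϱ`-neighbourhood of a core, is counted there
at most once (lattice translates of distinct motif sites differ), and a `ϱ`-neighbourhood holds `≤ (2ϱ/s + 1)³` points. -/
theorem shellCount_le_of_coversShell (hW : CoversShell W) {Q : PeriodicConfiguration 3} (hG : Guard ε s Q) (hs : 0 < s) (hϱ : 0 ≤ ϱ) :
    (shellCount W Q : ℝ) ≤ (2 * ϱ / s + 1) ^ 3 * (motifCoreIncoherent θ ε R r η L δ L' Q : ℝ) := by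
  set P : Finset (Σ _ : Q.motif, E3) := (Finset.univ : Finset Q.motif).sigma fun x =>
    if IsCore θ ε R r η L δ L' Q x then nearPoints ϱ Q (x : E3) else ∅ with hP
  have hex : ∀ y : Q.motif, ∃ p : Σ _ : Q.motif, E3, InShell W Q y → p ∈ P ∧ ∃ g ∈ Q.lattice, p.2 = (y : E3) - g := by
    intro y
    by_cases h : InShell W Q y
    · obtain ⟨x, hx, g, hg, hd⟩ := hW Q (y : E3) h.2
      refine ⟨⟨x, (y : E3) - g⟩, fun _ => ⟨?_, g, hg, rfl⟩⟩
      rw [hP, Finset.mem_sigma]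
      refine ⟨Finset.mem_univ _, ?_⟩
      rw [if_pos hx]
      refine mem_nearPoints.2 ⟨?_, ?_⟩
      · simpa [sub_eq_add_neg] using Q.add_mem_points (Q.mem_points_of_mem_motif y.2) (Q.lattice.neg_mem hg)
      · have h1 : dist ((y : E3) - g) (x : E3) = dist (y : E3) ((x : E3) + g) := by
          rw [dist_eq_norm, dist_eq_norm]; congr 1; abel
        rw [h1]; exact hd
    · exact ⟨⟨y, (y : E3)⟩, fun h' => absurd h' h⟩
  choose F hF using hex
  set N : Finset Q.motif := Finset.univ.filter fun y : Q.motif => InShell W Q y with hN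
  have hmemN : ∀ {y : Q.motif}, y ∈ N → InShell W Q y := fun hy => (Finset.mem_filter.1 hy).2
  have hinj : Set.InjOn F ↑N := by
    intro y₁ hy₁ y₂ hy₂ h12
    obtain ⟨g₁, hg₁, h₁⟩ := (hF y₁ (hmemN hy₁)).2
    obtain ⟨g₂, hg₂, h₂⟩ := (hF y₂ (hmemN hy₂)).2
    have h : (y₁ : E3) - g₁ = (y₂ : E3) - g₂ := by rw [← h₁, ← h₂, h12]
    have hsub : (y₁ : E3) - (y₂ : E3) ∈ Q.lattice := by
      rw [sub_eq_sub_iff_sub_eq_sub.1 h]; exact Q.lattice.sub_mem hg₁ hg₂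
    exact Subtype.ext (Q.eq_of_sub_mem _ y₁.2 _ y₂.2 hsub)
  have hsub : N.image F ⊆ P := by
    intro p hp
    obtain ⟨y, hy, rfl⟩ := Finset.mem_image.1 hp
    exact (hF y (hmemN hy)).1
  have hcardN : (shellCount W Q : ℝ) = (N.card : ℝ) := by
    rw [shellCount, Nat.card_eq_fintype_card, Fintype.card_subtype]
  have h1 : N.card ≤ P.card :=
    calc N.card = (N.image F).card := (Finset.card_image_of_injOn hinj).symm
      _ ≤ P.card := Finset.card_le_card hsub
  have h2 : (P.card : ℝ) = ∑ x : Q.motif, if IsCore θ ε R r η L δ L' Q x then ((nearPoints ϱ Q (x : E3)).card : ℝ) else 0 := by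
    rw [hP, Finset.card_sigma, Nat.cast_sum]
    refine Finset.sum_congr rfl fun x _ => ?_
    split_ifs <;> simp
  have h3 : (∑ x : Q.motif, if IsCore θ ε R r η L δ L' Q x then ((nearPoints ϱ Q (x : E3)).card : ℝ) else 0) ≤
      (2 * ϱ / s + 1) ^ 3 * (motifCoreIncoherent θ ε R r η L δ L' Q : ℝ) := by
    rw [← sum_ite_isCore_eq θ ε R r η L δ L' Q, Finset.mul_sum]
    refine Finset.sum_le_sum fun x _ => ?_
    by_cases hx : IsCore θ ε R r η L δ L' Q x
    · rw [if_pos hx, if_pos hx, mul_one]; exact card_nearPoints_le hG hs hϱ _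
    · rw [if_neg hx, if_neg hx, mul_zero]
  calc (shellCount W Q : ℝ) = (N.card : ℝ) := hcardN
    _ ≤ (P.card : ℝ) := by exact_mod_cast h1
    _ = _ := h2
    _ ≤ _ := h3

/-- ★ Hence SHELL-BUDGET_W holds OUTRIGHT at the packing constant `B₀ = (2ϱ/s + 1)³` (`0 < s`, `0 ≤ ϱ`, `W` covers its shell). -/
theorem shellBudgetW_of_coversShell (hW : CoversShell W) (hs : 0 < s) (hϱ : 0 ≤ ϱ) : ShellBudgetW W s ((2 * ϱ / s + 1) ^ 3) :=
  fun _ hQ => shellCount_le_of_coversShell hW hQ hs hϱ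

variable {c₁ ρ₀ lam ℓ : ℝ}

/-- ★ **EQUIV AT THE PACKING END OF THE DIAL**: for a weight system that covers its shell, CB-FAR_W|cored ⟺ CB-FAR_W|cored,`(2ϱ/s+1)³`
(`0 < s`, `0 ≤ ϱ`) — the split has content only for budgets below the packing constant. -/
theorem farLabelledFloorCoredW_iff_budget_packing (hW : CoversShell W) (hs : 0 < s) (hϱ : 0 ≤ ϱ) :
    FarLabelledFloorCoredW W c₁ s ρ₀ lam ℓ ↔ FarLabelledFloorCoredBudgetW W c₁ s ρ₀ lam ℓ ((2 * ϱ / s + 1) ^ 3) :=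
  ⟨farLabelledFloorCoredBudgetW_of_cored W, farLabelledFloorCoredW_of_shellBudget W (shellBudgetW_of_coversShell hW hs hϱ)⟩

/-- A positive core bump at `q` exhibits an incoherent core orbit within `ϱ` of `q` (`0 < ϱ`). -/
theorem exists_core_near_of_coreBump_pos (hϱ : 0 < ϱ) {Q : PeriodicConfiguration 3} {x : Q.motif} {q : E3}
    (hx : 0 < coreBump θ ε R r η L δ L' ϱ Q x q) : IsCore θ ε R r η L δ L' Q x ∧ ∃ g ∈ Q.lattice, dist q ((x : E3) + g) ≤ ϱ := by
  have hcore : IsCore θ ε R r η L δ L' Q x := by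
    by_contra hnc
    rw [coreBump_of_not_isCore hnc q] at hx
    exact lt_irrefl _ hx
  have hb : 0 < bump ϱ Q x q := by rwa [coreBump, if_pos hcore] at hx
  have hd : orbitDist Q x q < ϱ := by
    by_contra hle
    rw [bump_eq_zero_of_le hϱ (not_lt.1 hle)] at hb
    exact lt_irrefl _ hb
  have hd' : Metric.infDist q {z : E3 | ∃ g ∈ Q.lattice, z = (x : E3) + g} < ϱ := hd
  have hne : ({z : E3 | ∃ g ∈ Q.lattice, z = (x : E3) + g} : Set E3).Nonempty := ⟨(x : E3) + 0, 0, Q.lattice.zero_mem, rfl⟩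
  obtain ⟨z, ⟨g, hg, rfl⟩, hz⟩ := (Metric.infDist_lt_iff hne).1 hd'
  exact ⟨hcore, g, hg, hz.le⟩

/-- ★ The weights of record cover their shell (`0 < ϱ`): `farWeight < 1 ⟹ coverSum > 0 ⟹` a positive core bump. -/
theorem coversShell_record (hϱ : 0 < ϱ) : CoversShell (recordWeights θ ε R r η L δ L' ϱ) := by
  intro Q q hq
  change farWeight θ ε R r η L δ L' ϱ Q q < 1 at hq
  have hS : coverSum θ ε R r η L δ L' ϱ Q q ≠ 0 := fun h0 => by
    rw [farWeight_eq_one_of_coverSum_eq_zero h0] at hq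
    exact lt_irrefl _ hq
  have hex : ∃ x : Q.motif, 0 < coreBump θ ε R r η L δ L' ϱ Q x q := by
    by_contra hno
    refine hS (le_antisymm ?_ (coverSum_nonneg Q q))
    exact Finset.sum_nonpos fun x _ => not_lt.1 (not_exists.1 hno x)
  obtain ⟨x, hx⟩ := hex
  obtain ⟨hcore, g, hg, hd⟩ := exists_core_near_of_coreBump_pos hϱ hx
  exact ⟨x, hcore, g, hg, hd⟩

/-- Hence, for the weights of record at any positive scale, SHELL-BUDGET holds at the packing constant and the budget leaf at that
constant IS CB-FAR_G|cored of record (`0 < s`). -/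
theorem farLabelledFloorCoredG_iff_budget_packing (hϱ : 0 < ϱ) (hs : 0 < s) :
    FarLabelledFloorCoredG θ ε R r η L δ L' ϱ c₁ s ρ₀ lam ℓ ↔
      FarLabelledFloorCoredBudgetW (recordWeights θ ε R r η L δ L' ϱ) c₁ s ρ₀ lam ℓ ((2 * ϱ / s + 1) ^ 3) :=
  farLabelledFloorCoredW_record_iff.symm.trans (farLabelledFloorCoredW_iff_budget_packing (coversShell_record hϱ) hs hϱ.le)

end Covers

/-! ## §3 The record budget `B₀ = 10⁵` and ★★ the nine-leaf cone for every weight system -/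

section Record

/-- ★★ **THE NINE-LEAF RECORD CONE FOR EVERY WEIGHT SYSTEM**: `ChargeRecount · IP_G · FCP_G · CCP_G · REG-BALL_W · LABEL_W ·
SHELL-BUDGET_W(10⁵) · CB-FAR_W|cored,10⁵ · P_G ⟹ ChargedEnergyGap` at the record dials, any `ϱ`, any `W`. -/
theorem chargedEnergyGap_of_budgetLedger {ϱ : ℝ} (W : CoreWeights (3 / 20) (1 / 10) (6 / 5) 10 (1 / 100) 40 (1 / 10) 40 ϱ)
    (hF : ChargeRecount)
    (hIP : ImprovablePricingG (3 / 20) (1 / 10) (6 / 5) 10 (1 / 100) (3 / 5))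
    (hFCP : FrustratedCorePricingG (3 / 20) (1 / 10) (6 / 5) 10 (1 / 100) 40 (3 / 5))
    (hCCP : CoherentCorePricingG (3 / 20) (1 / 10) (6 / 5) 10 (1 / 100) 40 (1 / 10) 40 (3 / 5))
    (hB : CoreBallRegularPricingW W (1 / 20) (3 / 5) 10 fun _ _ => True)
    (hLab : CleanLabellingW W (3 / 5) 10 (1 / 3) 3)
    (hSB : ShellBudgetW W (3 / 5) 100000)
    (hCB : FarLabelledFloorCoredBudgetW W (1 / 20) (3 / 5) 10 (1 / 3) 3 100000)
    (hP : ChartedChargePricingG (3 / 20) (1 / 10) (3 / 5)) : ChargedEnergyGap :=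
  chargedEnergyGap_of_weightLedger W hF hIP hFCP hCCP hB hLab (farLabelledFloorCoredW_of_shellBudget W hSB hCB) hP

/-- At the record scale `ϱ = 160` and guard `s = 3/5` the packing constant is `(1603/3)³ ≈ 1.53·10⁸`: the record budget `10⁵` sits a
factor `> 1500` below the end of the dial where the split is vacuous. -/
theorem record_budget_lt_packing : (100000 : ℝ) * 1500 < (2 * 160 / (3 / 5) + 1) ^ 3 := by norm_num

end Record

end Summit.AtomisticToContinuum.Crystallization.Theorems.ChargedEnergyGapChartDial

end
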